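import Literature.MathematicalPhysics.QuantumFieldTheory.Balaban1983to89.B5G183Strip
import Literature.MathematicalPhysics.QuantumFieldTheory.Balaban1983to89.B5Hk163Alias
import Literature.MathematicalPhysics.QuantumFieldTheory.Balaban1983to89.B4Green244

/-!
# `Balaban1983to89.B5G183Alias` — the ALIAS RE-INDEXING COVARIANCE of the continued (1.83) entry symbol of `G = Δ₁⁻¹` across the sides of the zero-free strip (cell node X9, successor of `B5G183Strip`)

T. Bałaban, *Propagators and renormalization transformations for lattice gauge theories. I*, Commun. Math.
Phys. **95**, 17–40 (1984) [`Balaban1984PropagatorsI`, cell paper B5], (1.83)–(1.84) p. 31 [PDF 15] and the text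
after (1.87)/(1.88) p. 32 [PDF 16] — the formula whose regrouped holomorphic continuation `g183 μ ν l l′ (p′)` is the
object of the tree module `B5G183Strip` (its `[cite: …]` tags mark the location of the printed TEXT of the formula
only; no render is re-read by this unit and no sentence of the paper is quoted or used below).

CITATION HEADER (lean-in-tree rule).  This module is a SUPPLEMENT, not a quotation: it proves, for the regrouped
zero-free normal form `g183` of `B5G183Strip` (the `((l,μ),(l′,ν))` entry of the fiber matrix of `G = Δ₁⁻¹`, `a = 1`,
`U = 1`, continued to complex `p′`), the RE-INDEXING LAW across the strip sides
`g_{μν}(l,l′; p′ + 2πe_i) = g_{μν}(σ_i l, σ_i l′; p′)` at the side points `Re p′_i = −π` of `Strip d κ`,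
`0 ≤ κ ≤ κ₁₈₃(d)`, every `n ≥ 1` — the (1.83) analogue of `B5Hk163Alias.h163_tr` ((1.63), cell node X10) and of
`B5Symbol166Strip.W166_tr` ((1.66)).  B5 prints no complex continuation and no such law; everything below is
`[folklore]` audit mathematics.  ABSOLUTE RULE honoured: no statement of the papers is used as a hypothesis; the
imports are kernel-proved tree modules only (`B5G183Strip` = the regrouped symbol, its identification with
`B5Prop11Fiber.balabanFiber….G` on real momenta and its zero-free strip; `B5Hk163Alias` = the leaf shift laws
`vCbar_tr`, `uCbar_tr`, `dC_tr`, `expFacNeg_tr`; `B4Green244` = the exact one-coordinate identity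
`v̄·v = S₁/S_ξ` off `w = 1`, `vb_mul_v_of_w_ne_one`).  No constant is attributed to print.

THE MECHANISM (the audit's).  `g183` is assembled in `B5G183Strip` from branches in which every vanishing factor
`Δ(p′)` of (1.83) has been cancelled SYMBOLICALLY at the special alias index `l = 0` (`pairD`, `diagG`, `B1`, `B2`
are `if l = 0 then … else …`).  The translate `p′ ↦ p′ + 2πe_i` does NOT map the index `0` to itself
(`σ_i 0 = e_i ≠ 0`) and `Δ(p′ + 2πe_i) = Δ(p′ + 2π σ_i 0) ≠ Δ(p′)` (`B5Strip145Analytic.DeltaXi_tr`), so no branch is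
covariant by itself.  At a side point, however, `Δ(p′) ≠ 0` AND `Δ(p′ + 2πe_i) ≠ 0`
(`B5Symbol166Strip.edge_conditions`), and there every branch agrees with ONE uniform field expression (§3:
`pairD_eq_div`, `diagG_eq_U`, `B1_eq_U`, `B2_eq_U`) — the case splits of `B5G183Strip` were DESIGNED as the
symbolic cancellations of the uniform formulas, and undoing them is exactly the (1.87)/(1.88) consistency
`c_μ = |u v_μ|²(p′)` (continued: `cfac_eq_leaves`) and `∂_μ(p′)·c_μ = v̄_μ(p′)·∂¹_μ·U_0` (`dC_mul_cfac`), which rest on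
the exact complex leaf identities of §2: `v̄C·vC = uFactor` (`l = 0`, `|Re p′_μ| < 2π`), `ūC·uC = U_0`,
`∂_μ(p′+l)·vC_μ(p′+l) = e^{ip′_μ} − 1` (a telescoping geometric sum, every `l`) and its conjugate mirror.  The uniform
expression is then covariant up to explicit powers of `c := Δ(p′+2πe_i)/Δ(p′)`: the numerator `Δ(p′)` and `Y^G_λ`
pick up `c` (`YG_tr_mul`), `ΠY^G` picks up `c^d`, `E^G` picks up `c^{d−1}` hence `F^G = E^G/Δ` picks up `c^{d−2}`
(`EG_tr_mul`, `FG_tr_mul`), `𝒩` picks up `c²` (`B5Strip145Analytic.Ncal_tr`), the shifted `Δ(p′+l)` are permuted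
(`DeltaXi_shift_tr`) and the leaves are permuted (§1); so `diagU` is exactly covariant (`c/c`), `B1U`, `B2U` pick up
`c⁻¹` each and `midG = ΠY^G/F^G` picks up `c²`: the third term `midG·B1U·B2U` is exactly covariant, and so is `g183`.
All of §3–§5 is identities of field expressions closed by `field_simp`/`ring` from the named nonvanishing facts.

CONTENT.
* §1 the remaining leaf shift laws `vC_tr`, `uC_tr`, `dCbar_tr`, `expFacPos_tr` (dictionary `vC = B4Green244.vb`,
  `dCbar = n(w − 1)`);
* §2 the exact complex leaf identities `vCbar_mul_vC_zero`, `uCbar_mul_uC_zero`, `dC_mul_vC`, `dCbar_mul_vCbar`,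
  `cfac_eq_leaves`, `dC_mul_cfac`, `dCbar_mul_cfac`;
* §3 the uniform formulas `diagU`, `B1U`, `B2U` and `pairD_eq_div`, `RG_eq_div`, `Xne_eq_div`, `diagG_eq_U`,
  `B1_eq_U`, `B2_eq_U`, `g183_eq_U` (valid once `Δ(p′) ≠ 0`, `𝒩 ≠ 0`, `Y^G_λ ≠ 0`, `|Re p′_λ| < 2π`);
* §4 the quasi-periodicity of the `G`-denominators `YG_tr_mul`, `prodYG_tr_mul`, `EG_tr_mul`, `FG_tr_mul`;
* §5 **the covariance**: `diagU_tr` (exact), `B1U_tr_mul`, `B2U_tr_mul` (factor `Δ(p′)/Δ(p′+2πe_i)`), `midG_tr_mul`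
  (factor `(Δ(p′+2πe_i)/Δ(p′))²`), `third_tr` (exact), the main theorem **`g183_tr`**: for `p′ ∈ Strip d κ`,
  `0 ≤ κ ≤ kappa183 d`, `Re p′_i = −π`, all `n ≥ 1`, `μ, ν, l, l′`:
  `g183 n μ ν l l′ (tr p′ i) = g183 n μ ν (σ_i l) (σ_i l′) p′` (`tr`, `sigma` of `B5Strip145Analytic`), and
  `sum_norm_g183_sigma` (the permuted double alias sum is the double alias sum, so `B5G183Strip.norm_g183_le`
  bounds both sides alike).

HONEST SCOPE.  (i) The covariance is stated at the side points `Re p′_i = −π` only (the form the rectangle contour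
uses: the fiber matrix `(g(l,l′))_{l,l′}` is CONJUGATED BY THE PERMUTATION `σ_i`, and the kernel phases
`e^{i(p′+l)x}`, `e^{−i(p′+l′)y}` depend on `p′ + l`, `p′ + l′` only, so the fine-momentum integrand takes the same values
on the two sides); no per-`(l,l′)` periodicity holds and none is claimed; away from the sides (where `Δ(p′)` may
vanish, e.g. at `p′ = 0`) the uniform formulas of §3 are not available and are not used.  (ii) Nothing here is a
BOUND: the per-entry strip bound `‖g183(l,l′;p′)‖ ≤ M183 d` (uniform in `n`, `l`, `l′`) is `B5G183Strip.norm_g183_le`.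
WARNING for the successor (decay layer, cell GAPS row G-ne2p2-9 (β)): unlike (1.63) (`B5Hk163Alias.sum_norm_h163_le`)
the DOUBLE alias sum `Σ_{l,l′} ‖g183(l,l′;p′)‖` is NOT bounded uniformly in `n` — its diagonal part contains the free
fine-lattice terms `δ_{ll′}/Δ(p′+l)`, `l ≠ 0`, and `Σ_{l≠0} 1/|Δ(p′+l)| ≍ Σ_{l≠0} W_n(l)⁻¹` (`B4StripSums.W`) is of
order `n^{d−2}` for `d ≥ 3` (`log n` for `d = 2`): the coinciding-point size `η^{2−d}` of the kernel of `Δ₁⁻¹` on the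
`η`-lattice.  So a fine-offset multiplier `Σ_{l,l′} e^{i(p′+l)ηa} g(l,l′;p′) e^{−i(p′+l′)ηb}` assembled as in
`B5Hk163Decay` has an `n`-DEPENDENT strip bound, and the decay statement for X9 must either carry B5's short-distance
factor (`d(y,y′)^{−(d−2)}`-type bounds) or be made for the regular part `g183 − δ_{μν}δ_{ll′}/Δ(p′+l)` (every other
term carries the decaying leaves `ū(p′+l)`, `u(p′+l′)` and one shifted `Δ` per alias index, the situation of
`B5Hk163Alias` §1–§3); neither the periodic-kernel assembly nor a `StripRegular` instance nor the decay via
`B4ContourShift` is done here.  (iii) `U = 1`, `a = 1` (the `a` of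
(1.84) enters `B5G183Strip` as `a = 1` only), `n ≥ 1` arbitrary (`[NeZero n]`), as in the whole b05/pv15 lineage.
Float cross-check (cell archive `b2b-balaban-pv15-g10/num/check183alias.py|.out`, direct transcription of the
regrouped formulas): 17 098 side-point comparisons `(d,n) ∈ {(2,2),(2,3),(2,4),(3,2),(3,3)}`, all `μ,ν,l,l′`, agree to
`2.3e-15` (values of `|g|` between `3.6e-7` and `1.3`), and `E^G = Δ·F^G` to `4e-16`.
Value = kernel certificate (side covariance = one of the two remaining analyticity inputs for the kernel of `G` via
(1.83), cell GAPS row G-ne2p2-9 (β) for X9), NOT summit progress.  Unit `b2b-balaban-pv15-g10` (PV15 cell lineage,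
generation 10; author of `B5G183Strip`).
REVISION LOG. v1 = p188523 (commit 10124451619b).  v1.1 (this text; DOCSTRING-ONLY, no declaration, statement or proof
touched): HONEST SCOPE (ii) rewritten — v1 called the per-entry bound `B5G183Strip.norm_g183_le` «the alias-sum bound»;
it is a per-entry bound, and the double alias sum is `n`-dependent (the free fine-lattice diagonal), now said
explicitly with the consequence for the decay layer; docstring of `sum_norm_g183_sigma` adjusted accordingly.
-/

open scoped BigOperators ComplexConjugate Real
open Finset Complex

namespace Literature.MathematicalPhysics.QuantumFieldTheory.Balaban1983to89.B5G183Alias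

open Literature.MathematicalPhysics.QuantumFieldTheory.Balaban1983to89.B4Strip
open Literature.MathematicalPhysics.QuantumFieldTheory.Balaban1983to89.B4StripCauchy
open Literature.MathematicalPhysics.QuantumFieldTheory.Balaban1983to89.B5Symbol166
open Literature.MathematicalPhysics.QuantumFieldTheory.Balaban1983to89.B5Strip145
open Literature.MathematicalPhysics.QuantumFieldTheory.Balaban1983to89.B5Strip145Analytic
open Literature.MathematicalPhysics.QuantumFieldTheory.Balaban1983to89.B5Symbol166Strip hiding Afac
open Literature.MathematicalPhysics.QuantumFieldTheory.Balaban1983to89.B5Hk163Strip hiding Afac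
open Literature.MathematicalPhysics.QuantumFieldTheory.Balaban1983to89.B5Hk163Alias
open Literature.MathematicalPhysics.QuantumFieldTheory.Balaban1983to89.B5G183Strip
open Literature.MathematicalPhysics.QuantumFieldTheory.Balaban1983to89.B4StripSums (v w ef w_pow w_ne_one
  tr_mem_Strip w_add_two_pi v_add_two_pi)
open Literature.MathematicalPhysics.QuantumFieldTheory.Balaban1983to89.B4Green244 (vb ef_eq_inv_w_pow
  vb_mul_v_of_w_ne_one w_ne_zero)

variable {d : ℕ}

/-! ## §1. The remaining leaf shifts: `vC`, `uC`, `dCbar`, `expFacPos` -/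

section Leaves

variable (n : ℕ) [NeZero n]

omit [NeZero n] in
/-- the geometric-mean leaf `vC_μ(p′+l)` IS the conjugate one-coordinate factor `v̄_n(l_μ; p_μ)` of `B4Green244`.
[folklore] -/
theorem vC_eq_vb (k : Fin d → Fin n) (p : Fin d → ℂ) (μ : Fin d) :
    vC n k p μ = vb n (k μ : ℕ) (p μ) := by
  unfold vC vb ef
  rw [div_eq_inv_mul, Finset.sum_range (fun s => Complex.exp (I * (p μ + 2 * π * ((k μ : ℕ) : ℂ)) * (s : ℕ) / n))]
  congr 1
  refine Finset.sum_congr rfl (fun j _ => ?_)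
  congr 1
  simp only [shift]
  ring

omit [NeZero n] in
/-- `vC` as a geometric sum in the inverse phase `w⁻¹`. [folklore] -/
theorem vC_eq_sum_w (k : Fin d → Fin n) (p : Fin d → ℂ) (μ : Fin d) :
    vC n k p μ = (∑ j : Fin n, ((w n (k μ : ℕ) (p μ))⁻¹) ^ (j : ℕ)) / n := by
  unfold vC
  congr 1
  refine Finset.sum_congr rfl (fun j _ => ?_)
  rw [← exp_shift_eq_inv_w, ← Complex.exp_nat_mul]
  ring_nf

/-- RE-INDEXING OF THE LEAF `vC`: `vC_μ(l; p′ + 2πe_ν) = vC_μ(σ_ν l; p′)` (no side condition). [folklore] -/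
theorem vC_tr (k : Fin d → Fin n) (p : Fin d → ℂ) (ν μ : Fin d) :
    vC n k (tr p ν) μ = vC n (sigma n ν k) p μ := by
  rw [vC_eq_sum_w, vC_eq_sum_w]
  by_cases h : μ = ν
  · subst h
    rw [tr_apply_self, sigma_apply_self, val_add_one_eq_mod, w_add_two_pi n (k μ) (NeZero.ne n) (p μ)]
  · rw [tr_apply_of_ne h, sigma_apply_of_ne n h]

/-- RE-INDEXING OF `uC`: `uC(l; p′ + 2πe_ν) = uC(σ_ν l; p′)`. [folklore] -/
theorem uC_tr (k : Fin d → Fin n) (p : Fin d → ℂ) (ν : Fin d) :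
    uC n k (tr p ν) = uC n (sigma n ν k) p := by
  unfold uC
  exact Finset.prod_congr rfl (fun μ _ => vC_tr n k p ν μ)

omit [NeZero n] in
/-- `dCbar` in the phase `w`: `conj ∂_μ(p′+l) = n(w − 1)`. [folklore] -/
theorem dCbar_eq_w (k : Fin d → Fin n) (p : Fin d → ℂ) (μ : Fin d) :
    dCbar n k p μ = (n : ℂ) * (w n (k μ : ℕ) (p μ) - 1) := by
  unfold dCbar
  congr 2
  rw [← inv_inv (Complex.exp _), ← Complex.exp_neg, neg_neg, exp_shift_eq_inv_w, inv_inv]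

/-- RE-INDEXING OF `conj ∂_μ(p′+l)`: `dCbar_μ(l; p′ + 2πe_ν) = dCbar_μ(σ_ν l; p′)`. [folklore] -/
theorem dCbar_tr (k : Fin d → Fin n) (p : Fin d → ℂ) (ν μ : Fin d) :
    dCbar n k (tr p ν) μ = dCbar n (sigma n ν k) p μ := by
  rw [dCbar_eq_w, dCbar_eq_w]
  by_cases h : μ = ν
  · subst h
    rw [tr_apply_self, sigma_apply_self, val_add_one_eq_mod, w_add_two_pi n (k μ) (NeZero.ne n) (p μ)]
  · rw [tr_apply_of_ne h, sigma_apply_of_ne n h]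

omit [NeZero n] in
/-- `e^{ip_μ} − 1` is `2π`-periodic: `∂¹_μ(p′ + 2πe_ν) = ∂¹_μ(p′)`. [folklore] -/
theorem expFacPos_tr (μ ν : Fin d) (p : Fin d → ℂ) : expFacPos μ (tr p ν) = expFacPos μ p := by
  rw [tr_def]
  exact expFacPos_periodic μ ν p

/-! ## §2. The exact complex leaf identities `v̄C·vC = |v|²`, `ūC·uC = |u|²`, `∂·vC = ∂¹`, `∂̄·v̄C = ∂̄¹` -/

/-- **`v̄C_μ(p′)·vC_μ(p′) = uFactor(0, p′_μ)`** (the `l = 0` factor of `|u(p′)|²`, continued), for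
`|Re p′_μ| < 2π` (so that the only zero of `S_ξ(p′_μ)` there, `p′_μ = 0`, is the removable point where both
sides equal `1`). [folklore] -/
theorem vCbar_mul_vC_zero (hn : 1 ≤ n) (q : Fin d → ℂ) (μ : Fin d) (hx : |(q μ).re| < 2 * Real.pi) :
    vCbar n (fun _ => (0 : Fin n)) q μ * vC n (fun _ => (0 : Fin n)) q μ = uFactor n 0 (q μ) := by
  have hn0 : n ≠ 0 := by omega
  by_cases hz : q μ = 0
  · have hvb : vCbar n (fun _ => (0 : Fin n)) q μ = 1 := by
      unfold vCbar
      simp only [shift, Fin.val_zero, Nat.cast_zero, mul_zero, add_zero, hz, zero_div, zero_mul, neg_zero,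
        Complex.exp_zero, Finset.sum_const, Finset.card_univ, Fintype.card_fin, nsmul_eq_mul, mul_one]
      exact div_self (Nat.cast_ne_zero.mpr hn0)
    have hv : vC n (fun _ => (0 : Fin n)) q μ = 1 := by
      unfold vC
      simp only [shift, Fin.val_zero, Nat.cast_zero, mul_zero, add_zero, hz, zero_div, zero_mul,
        Complex.exp_zero, Finset.sum_const, Finset.card_univ, Fintype.card_fin, nsmul_eq_mul, mul_one]
      exact div_self (Nat.cast_ne_zero.mpr hn0)
    rw [hvb, hv, hz, one_mul]
    unfold uFactor
    simp
  · have hS : Sxi n (q μ + 2 * π * ((0 : ℕ) : ℂ)) ≠ 0 := by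
      rw [Nat.cast_zero, mul_zero, add_zero]
      exact Sxi_ne_zero n hn hx hz
    rw [vCbar_eq_v, vC_eq_vb, mul_comm, Fin.val_zero,
      vb_mul_v_of_w_ne_one n 0 hn0 (w_ne_one n 0 hS), uFactor_eq_div n 0 hz]

/-- **`ūC(p′)·uC(p′) = U_0(p′) = |u(p′)|²`** continued, for `|Re p′_λ| < 2π` (all `λ`). [folklore] -/
theorem uCbar_mul_uC_zero (hn : 1 ≤ n) (q : Fin d → ℂ) (hx : ∀ lam, |(q lam).re| < 2 * Real.pi) :
    uCbar n (fun _ => (0 : Fin n)) q * uC n (fun _ => (0 : Fin n)) q = U n (fun _ => (0 : Fin n)) q := by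
  unfold uCbar uC U
  rw [← Finset.prod_mul_distrib]
  exact Finset.prod_congr rfl (fun lam _ => by rw [vCbar_mul_vC_zero n hn q lam (hx lam), Fin.val_zero])

omit [NeZero n] in
/-- the telescoped product **`∂_μ(p′+l)·vC_μ(p′+l) = e^{ip′_μ} − 1 = ∂¹_μ(p′)`** (exact, every `l`: the
geometric sum `vC` times `W − 1` telescopes to `W^n − 1`, and `W^n = e^{i(p′_μ + 2πl_μ)} = e^{ip′_μ}`). [folklore] -/
theorem dC_mul_vC (hn0 : n ≠ 0) (k : Fin d → Fin n) (q : Fin d → ℂ) (μ : Fin d) :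
    dC n k q μ * vC n k q μ = expFacPos μ q := by
  have hn : (n : ℂ) ≠ 0 := Nat.cast_ne_zero.mpr hn0
  unfold dC vC expFacPos
  set z : ℂ := shift n k q μ / n * I with hz
  have hterm : ∀ j : ℕ, Complex.exp (z * (j : ℂ)) = (Complex.exp z) ^ j := by
    intro j
    rw [← Complex.exp_nat_mul]
    ring_nf
  have hsum : ∑ j : Fin n, Complex.exp (z * ((j : ℕ) : ℂ)) = ∑ j ∈ range n, (Complex.exp z) ^ j := by
    rw [← Fin.sum_univ_eq_sum_range (fun j => (Complex.exp z) ^ j) n]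
    exact Finset.sum_congr rfl (fun j _ => hterm j)
  rw [hsum]
  have htel : (∑ j ∈ range n, (Complex.exp z) ^ j) * (Complex.exp z - 1) = (Complex.exp z) ^ n - 1 :=
    geom_sum_mul _ _
  have hpow : (Complex.exp z) ^ n = Complex.exp (q μ * I) := by
    rw [← Complex.exp_nat_mul, hz]
    simp only [shift]
    rw [show (n : ℂ) * ((q μ + 2 * Real.pi * ((k μ : ℕ) : ℂ)) / n * I)
        = q μ * I + ((k μ : ℕ) : ℂ) * (2 * Real.pi * I) by field_simp,
      Complex.exp_add, Complex.exp_nat_mul_two_pi_mul_I, mul_one]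
  calc (n : ℂ) * (Complex.exp z - 1) * ((∑ j ∈ range n, Complex.exp z ^ j) / n)
      = (∑ j ∈ range n, Complex.exp z ^ j) * (Complex.exp z - 1) := by field_simp
    _ = Complex.exp (q μ * I) - 1 := by rw [htel, hpow]

omit [NeZero n] in
/-- the mirror **`conj ∂_μ(p′+l)·v̄C_μ(p′+l) = e^{−ip′_μ} − 1 = conj ∂¹_μ(p′)`** (exact, every `l`). [folklore] -/
theorem dCbar_mul_vCbar (hn0 : n ≠ 0) (k : Fin d → Fin n) (q : Fin d → ℂ) (μ : Fin d) :
    dCbar n k q μ * vCbar n k q μ = expFacNeg μ q := by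
  have hn : (n : ℂ) ≠ 0 := Nat.cast_ne_zero.mpr hn0
  unfold dCbar vCbar expFacNeg
  set z : ℂ := -(shift n k q μ / n * I) with hz
  have hterm : ∀ j : ℕ, Complex.exp (-(shift n k q μ / n * I * (j : ℂ))) = (Complex.exp z) ^ j := by
    intro j
    rw [← Complex.exp_nat_mul, hz]
    ring_nf
  have hsum : ∑ j : Fin n, Complex.exp (-(shift n k q μ / n * I * ((j : ℕ) : ℂ)))
      = ∑ j ∈ range n, (Complex.exp z) ^ j := by
    rw [← Fin.sum_univ_eq_sum_range (fun j => (Complex.exp z) ^ j) n]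
    exact Finset.sum_congr rfl (fun j _ => hterm j)
  rw [hsum]
  have htel : (∑ j ∈ range n, (Complex.exp z) ^ j) * (Complex.exp z - 1) = (Complex.exp z) ^ n - 1 :=
    geom_sum_mul _ _
  have hpow : (Complex.exp z) ^ n = Complex.exp (-(q μ * I)) := by
    rw [← Complex.exp_nat_mul, hz]
    simp only [shift]
    rw [show (n : ℂ) * -((q μ + 2 * Real.pi * ((k μ : ℕ) : ℂ)) / n * I)
        = -(q μ * I) + -(((k μ : ℕ) : ℂ) * (2 * Real.pi * I)) by field_simp; ring,
      Complex.exp_add, Complex.exp_neg (((k μ : ℕ) : ℂ) * _), Complex.exp_nat_mul_two_pi_mul_I, inv_one,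
      mul_one]
  calc (n : ℂ) * (Complex.exp z - 1) * ((∑ j ∈ range n, Complex.exp z ^ j) / n)
      = (∑ j ∈ range n, Complex.exp z ^ j) * (Complex.exp z - 1) := by field_simp
    _ = Complex.exp (-(q μ * I)) - 1 := by rw [htel, hpow]

/-- the (1.87)/(1.88) consistency at `l = 0`, first form: **`c_μ(p′) = ūC(p′)v̄C_μ(p′)·uC(p′)vC_μ(p′)`**
(`|u(p′)v_μ(p′)|²` continued), `|Re p′_λ| < 2π`. [folklore] -/
theorem cfac_eq_leaves (hn : 1 ≤ n) (q : Fin d → ℂ) (μ : Fin d) (hx : ∀ lam, |(q lam).re| < 2 * Real.pi) :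
    cfac n μ q = uCbar n (fun _ => (0 : Fin n)) q * vCbar n (fun _ => (0 : Fin n)) q μ
      * (uC n (fun _ => (0 : Fin n)) q * vC n (fun _ => (0 : Fin n)) q μ) := by
  unfold cfac
  rw [← uCbar_mul_uC_zero n hn q hx, ← vCbar_mul_vC_zero n hn q μ (hx μ)]
  ring

/-- the (1.88) consistency at `l = 0`, second form: **`∂_μ(p′)·c_μ(p′) = v̄C_μ(p′)·∂¹_μ(p′)·U_0(p′)`**. [folklore] -/
theorem dC_mul_cfac (hn : 1 ≤ n) (q : Fin d → ℂ) (μ : Fin d) (hx : ∀ lam, |(q lam).re| < 2 * Real.pi) :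
    dC n (fun _ => (0 : Fin n)) q μ * cfac n μ q
      = vCbar n (fun _ => (0 : Fin n)) q μ * expFacPos μ q * U n (fun _ => (0 : Fin n)) q := by
  unfold cfac
  rw [← vCbar_mul_vC_zero n hn q μ (hx μ), ← dC_mul_vC n (by omega) (fun _ => (0 : Fin n)) q μ]
  ring

/-- the mirror: **`conj ∂_μ(p′)·c_μ(p′) = vC_μ(p′)·conj ∂¹_μ(p′)·U_0(p′)`**. [folklore] -/
theorem dCbar_mul_cfac (hn : 1 ≤ n) (q : Fin d → ℂ) (μ : Fin d) (hx : ∀ lam, |(q lam).re| < 2 * Real.pi) :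
    dCbar n (fun _ => (0 : Fin n)) q μ * cfac n μ q
      = vC n (fun _ => (0 : Fin n)) q μ * expFacNeg μ q * U n (fun _ => (0 : Fin n)) q := by
  unfold cfac
  rw [← vCbar_mul_vC_zero n hn q μ (hx μ), ← dCbar_mul_vCbar n (by omega) (fun _ => (0 : Fin n)) q μ]
  ring

end Leaves

/-! ## §3. The UNIFORM formulas: the symbolic `l = 0` cancellations of `pairD`, `diagG`, `B1`, `B2` undone
once `Δ(p′) ≠ 0` (the (1.87)/(1.88) consistency, as identities of field expressions) -/

section Uniform

variable (n : ℕ) [NeZero n]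

/-- the uniform second term of `diagG`: `δ_{ll′}/Δ(p′+l) − ū(p′+l)v̄_μ(p′+l)·u(p′+l′)v_μ(p′+l′)·Δ(p′)/(Δ(p′+l)Δ(p′+l′)Y^G_μ)`
for EVERY pair `(l,l′)`. [folklore] -/
noncomputable def diagU (μ : Fin d) (k k' : Fin d → Fin n) (q : Fin d → ℂ) : ℂ :=
  (if k = k' then 1 / DeltaXi n 0 (shift n k q) else 0)
    - uCbar n k q * vCbar n k q μ * (uC n k' q * vC n k' q μ)
      * (DeltaXi n 0 q / (DeltaXi n 0 (shift n k q) * DeltaXi n 0 (shift n k' q))) / YG n μ q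

/-- the uniform first bracket: `ū(p′+l)·(∂_μ(p′+l)·Δ(p′)/(Δ²(p′+l)𝒩) − v̄_μ(p′+l)·∂¹_μ/(Y^G_μ·Δ(p′+l)))` for EVERY `l`.
[folklore] -/
noncomputable def B1U (μ : Fin d) (k : Fin d → Fin n) (q : Fin d → ℂ) : ℂ :=
  uCbar n k q * (dC n k q μ * DeltaXi n 0 q / (DeltaXi n 0 (shift n k q) ^ 2 * Ncal n q)
    - vCbar n k q μ * expFacPos μ q / (YG n μ q * DeltaXi n 0 (shift n k q)))

/-- the uniform second bracket (conjugate-leaf mirror of `B1U`). [folklore] -/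
noncomputable def B2U (ν : Fin d) (k' : Fin d → Fin n) (q : Fin d → ℂ) : ℂ :=
  uC n k' q * (dCbar n k' q ν * DeltaXi n 0 q / (DeltaXi n 0 (shift n k' q) ^ 2 * Ncal n q)
    - vC n k' q ν * expFacNeg ν q / (YG n ν q * DeltaXi n 0 (shift n k' q)))

/-- the generic formula `P(l,l′) = Δ(p′)/(Δ(p′+l)Δ(p′+l′))` for EVERY pair once `Δ(p′) ≠ 0`. [folklore] -/
theorem pairD_eq_div {q : Fin d → ℂ} (hq : DeltaXi n 0 q ≠ 0) (k k' : Fin d → Fin n) :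
    pairD n k k' q = DeltaXi n 0 q / (DeltaXi n 0 (shift n k q) * DeltaXi n 0 (shift n k' q)) := by
  unfold pairD
  by_cases hk : k = fun _ => 0
  · rw [if_pos hk, hk, shift_zero, ← div_div, div_self hq]
  · rw [if_neg hk]
    by_cases hk' : k' = fun _ => 0
    · rw [if_pos hk', hk', shift_zero, mul_comm (DeltaXi n 0 (shift n k q)) (DeltaXi n 0 q), ← div_div,
        div_self hq]
    · rw [if_neg hk']

/-- `R^G_μ = (Y^G_μ − c_μ)/Δ` once `Δ(p′) ≠ 0`. [folklore] -/
theorem RG_eq_div {q : Fin d → ℂ} (hq : DeltaXi n 0 q ≠ 0) (μ : Fin d) :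
    RG n μ q = (YG n μ q - cfac n μ q) / DeltaXi n 0 q := by
  rw [YG_eq]
  field_simp
  ring

/-- `X_{≠0} = (𝒩 − U_0)/Δ²` once `Δ(p′) ≠ 0`. [folklore] -/
theorem Xne_eq_div {q : Fin d → ℂ} (hq : DeltaXi n 0 q ≠ 0) :
    Xne n q = (Ncal n q - U n (fun _ => (0 : Fin n)) q) / DeltaXi n 0 q ^ 2 := by
  unfold Ncal
  field_simp
  ring

/-- **`diagG = diagU`** once `Δ(p′) ≠ 0` (and `Y^G_μ ≠ 0`, `|Re p′_λ| < 2π`): at `l = l′ = 0` this is the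
`l′ = l` cancellation `1/Δ − |u v_μ|²/(Δ·Y^G_μ) = R^G_μ/Y^G_μ` of (1.87), read backwards. [folklore] -/
theorem diagG_eq_U (hn : 1 ≤ n) {q : Fin d → ℂ} (hq : DeltaXi n 0 q ≠ 0) (μ : Fin d) (hY : YG n μ q ≠ 0)
    (hx : ∀ lam, |(q lam).re| < 2 * Real.pi) (k k' : Fin d → Fin n) :
    diagG n μ k k' q = diagU n μ k k' q := by
  unfold diagG diagU
  by_cases hkk : k = (fun _ => 0) ∧ k' = (fun _ => 0)
  · obtain ⟨rfl, rfl⟩ := hkk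
    rw [if_pos ⟨rfl, rfl⟩, if_pos rfl, shift_zero, ← cfac_eq_leaves n hn q μ hx, RG_eq_div n hq]
    field_simp
  · rw [if_neg hkk, pairD_eq_div n hq]

/-- **`B1 = B1U`** once `Δ(p′) ≠ 0` (and `𝒩, Y^G_μ ≠ 0`, `|Re p′_λ| < 2π`): at `l = 0` this is the `l″ = l`
cancellation of (1.88), read backwards (`∂_μ c_μ = v̄_μ ∂¹_μ U_0`). [folklore] -/
theorem B1_eq_U (hn : 1 ≤ n) {q : Fin d → ℂ} (hq : DeltaXi n 0 q ≠ 0) (hN : Ncal n q ≠ 0) (μ : Fin d)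
    (hY : YG n μ q ≠ 0) (hx : ∀ lam, |(q lam).re| < 2 * Real.pi) (k : Fin d → Fin n) :
    B1 n μ k q = B1U n μ k q := by
  unfold B1 B1U
  by_cases hk : k = fun _ => 0
  · subst hk
    have hRG : dC n (fun _ => (0 : Fin n)) q μ * RG n μ q
        = (dC n (fun _ => (0 : Fin n)) q μ * YG n μ q
            - vCbar n (fun _ => (0 : Fin n)) q μ * expFacPos μ q * U n (fun _ => (0 : Fin n)) q)
          / DeltaXi n 0 q := by
      rw [RG_eq_div n hq, mul_div_assoc', mul_sub, dC_mul_cfac n hn q μ hx]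
    rw [if_pos rfl, shift_zero, hRG, Xne_eq_div n hq]
    field_simp
    ring
  · rw [if_neg hk]

/-- **`B2 = B2U`** once `Δ(p′) ≠ 0` (mirror of `B1_eq_U`). [folklore] -/
theorem B2_eq_U (hn : 1 ≤ n) {q : Fin d → ℂ} (hq : DeltaXi n 0 q ≠ 0) (hN : Ncal n q ≠ 0) (ν : Fin d)
    (hY : YG n ν q ≠ 0) (hx : ∀ lam, |(q lam).re| < 2 * Real.pi) (k' : Fin d → Fin n) :
    B2 n ν k' q = B2U n ν k' q := by
  unfold B2 B2U
  by_cases hk : k' = fun _ => 0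
  · subst hk
    have hRG : dCbar n (fun _ => (0 : Fin n)) q ν * RG n ν q
        = (dCbar n (fun _ => (0 : Fin n)) q ν * YG n ν q
            - vC n (fun _ => (0 : Fin n)) q ν * expFacNeg ν q * U n (fun _ => (0 : Fin n)) q)
          / DeltaXi n 0 q := by
      rw [RG_eq_div n hq, mul_div_assoc', mul_sub, dCbar_mul_cfac n hn q ν hx]
    rw [if_pos rfl, shift_zero, hRG, Xne_eq_div n hq]
    field_simp
    ring
  · rw [if_neg hk]

/-- **THE UNIFORM FORM OF THE ENTRY SYMBOL** once `Δ(p′) ≠ 0`: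
`g = δ_{μν}·diagU + midG·B1U·B2U`. [folklore] -/
theorem g183_eq_U (hn : 1 ≤ n) {q : Fin d → ℂ} (hq : DeltaXi n 0 q ≠ 0) (hN : Ncal n q ≠ 0)
    (hY : ∀ lam, YG n lam q ≠ 0) (hx : ∀ lam, |(q lam).re| < 2 * Real.pi) (μ ν : Fin d)
    (k k' : Fin d → Fin n) :
    g183 n μ ν k k' q = (if μ = ν then diagU n μ k k' q else 0) + midG n q * B1U n μ k q * B2U n ν k' q := by
  unfold g183
  rw [B1_eq_U n hn hq hN μ (hY μ) hx, B2_eq_U n hn hq hN ν (hY ν) hx]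
  congr 1
  split_ifs with h
  · exact diagG_eq_U n hn hq μ (hY μ) hx k k'
  · rfl

end Uniform

/-! ## §4. The shift laws of the `G`-denominators (quasi-periodicity with powers of `Δ(p′+2πe_i)/Δ(p′)`) -/

section Shift

variable (n : ℕ) [NeZero n]

/-- QUASI-PERIODICITY OF `Y^G_λ`: `Y^G_λ(p + 2πe_i)·Δ(p) = Δ(p + 2πe_i)·Y^G_λ(p)`. [folklore] -/
theorem YG_tr_mul (lam : Fin d) (p : Fin d → ℂ) (i : Fin d) (hz : p i ≠ 0)
    (hz' : p i + 2 * Real.pi ≠ 0) (h0 : DeltaXi n 0 p ≠ 0) (h1 : DeltaXi n 0 (tr p i) ≠ 0) :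
    YG n lam (tr p i) * DeltaXi n 0 p = DeltaXi n 0 (tr p i) * YG n lam p := by
  unfold YG
  linear_combination Yc_tr_mul n lam p i hz hz' h0 h1

/-- products: `(Π_S Y^G_λ(p + 2πe_i))·Δ(p)^{|S|} = Δ(p + 2πe_i)^{|S|}·Π_S Y^G_λ(p)`. [folklore] -/
theorem prodYG_tr_mul (S : Finset (Fin d)) (p : Fin d → ℂ) (i : Fin d) (hz : p i ≠ 0)
    (hz' : p i + 2 * Real.pi ≠ 0) (h0 : DeltaXi n 0 p ≠ 0) (h1 : DeltaXi n 0 (tr p i) ≠ 0) :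
    (∏ lam ∈ S, YG n lam (tr p i)) * DeltaXi n 0 p ^ S.card
      = DeltaXi n 0 (tr p i) ^ S.card * ∏ lam ∈ S, YG n lam p := by
  rw [← Finset.prod_const, ← Finset.prod_mul_distrib, ← Finset.prod_const, ← Finset.prod_mul_distrib]
  exact Finset.prod_congr rfl (fun lam _ => YG_tr_mul n lam p i hz hz' h0 h1)

/-- QUASI-PERIODICITY OF `E^G`: `E^G(p + 2πe_i)·Δ(p)^{d−1} = Δ(p + 2πe_i)^{d−1}·E^G(p)`. [folklore] -/
theorem EG_tr_mul (p : Fin d → ℂ) (i : Fin d) (hz : p i ≠ 0)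
    (hz' : p i + 2 * Real.pi ≠ 0) (h0 : DeltaXi n 0 p ≠ 0) (h1 : DeltaXi n 0 (tr p i) ≠ 0) :
    EG n (tr p i) * DeltaXi n 0 p ^ (d - 1) = DeltaXi n 0 (tr p i) ^ (d - 1) * EG n p := by
  unfold EG
  rw [Finset.sum_mul, Finset.mul_sum]
  refine Finset.sum_congr rfl (fun lam _ => ?_)
  have hcard : (univ.erase lam).card = d - 1 := by
    rw [Finset.card_erase_of_mem (Finset.mem_univ lam), Finset.card_univ, Fintype.card_fin]
  have h := prodYG_tr_mul n (univ.erase lam) p i hz hz' h0 h1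
  rw [hcard] at h
  rw [S1_coord_tr, mul_assoc, h]
  ring

/-- QUASI-PERIODICITY OF `F^G` (through `E^G = Δ·F^G`):
`Δ(p + 2πe_i)·F^G(p + 2πe_i)·Δ(p)^{d−1} = Δ(p + 2πe_i)^{d−1}·Δ(p)·F^G(p)`. [folklore] -/
theorem FG_tr_mul (p : Fin d → ℂ) (i : Fin d) (hz : p i ≠ 0)
    (hz' : p i + 2 * Real.pi ≠ 0) (h0 : DeltaXi n 0 p ≠ 0) (h1 : DeltaXi n 0 (tr p i) ≠ 0) :
    DeltaXi n 0 (tr p i) * FG n (tr p i) * DeltaXi n 0 p ^ (d - 1)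
      = DeltaXi n 0 (tr p i) ^ (d - 1) * (DeltaXi n 0 p * FG n p) := by
  rw [← EG_eq_mul, ← EG_eq_mul]
  exact EG_tr_mul n p i hz hz' h0 h1

end Shift

/-! ## §5. The re-indexing covariance across the strip side `Re p′_i = −π` -/

section Covariance

variable (n : ℕ) [NeZero n]

/-- a strip point has `|Re p_λ| < 2π` in every coordinate. [folklore] -/
theorem re_lt_two_pi {κ : ℝ} {p : Fin d → ℂ} (hp : p ∈ Strip d κ) (lam : Fin d) :
    |(p lam).re| < 2 * Real.pi :=
  lt_of_le_of_lt (hp lam).1 (by linarith [Real.pi_pos])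

/-- every shifted `Δ(p′ + σ_i l)` is nonzero at an edge point (for `σ_i l = 0` it is `Δ(p′)` itself). [folklore] -/
theorem DeltaXi_shift_sigma_ne_zero {p : Fin d → ℂ} (i : Fin d) (h0 : DeltaXi n 0 p ≠ 0)
    (hD : ∀ k : Fin d → Fin n, k ≠ (fun _ => 0) → DeltaXi n 0 (shift n k p) ≠ 0) (k : Fin d → Fin n) :
    DeltaXi n 0 (shift n (sigma n i k) p) ≠ 0 := by
  by_cases hk : sigma n i k = fun _ => 0
  · rw [hk, shift_zero]; exact h0
  · exact hD _ hk

/-- **EXACT COVARIANCE OF THE UNIFORM DIAGONAL TERM**: `diagU_{l,l′}(p′ + 2πe_i) = diagU_{σl,σl′}(p′)`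
(the factor `Δ(p′+2πe_i)/Δ(p′)` of the numerator `Δ` cancels against that of `Y^G_μ`). [folklore] -/
theorem diagU_tr (μ : Fin d) (k k' : Fin d → Fin n) {p : Fin d → ℂ} (i : Fin d) (hz : p i ≠ 0)
    (hz' : p i + 2 * Real.pi ≠ 0) (h0 : DeltaXi n 0 p ≠ 0) (h1 : DeltaXi n 0 (tr p i) ≠ 0)
    (hY : YG n μ p ≠ 0)
    (hD : ∀ k : Fin d → Fin n, k ≠ (fun _ => 0) → DeltaXi n 0 (shift n k p) ≠ 0) :
    diagU n μ k k' (tr p i) = diagU n μ (sigma n i k) (sigma n i k') p := by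
  have hYt : YG n μ (tr p i) = DeltaXi n 0 (tr p i) * YG n μ p / DeltaXi n 0 p :=
    eq_div_of_mul_eq h0 (YG_tr_mul n μ p i hz hz' h0 h1)
  have hsk := DeltaXi_shift_sigma_ne_zero n i h0 hD k
  have hsk' := DeltaXi_shift_sigma_ne_zero n i h0 hD k'
  unfold diagU
  rw [uCbar_tr, vCbar_tr, uC_tr, vC_tr, DeltaXi_shift_tr, DeltaXi_shift_tr, hYt]
  by_cases hkk : k = k'
  · subst hkk
    rw [if_pos rfl, if_pos rfl]
    field_simp
  · have hne : sigma n i k ≠ sigma n i k' := fun h => hkk ((sigmaEquiv n i).injective h)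
    rw [if_neg hkk, if_neg hne]
    field_simp

/-- **THE SHIFT LAW OF THE FIRST BRACKET**: `B1U_l(p′ + 2πe_i)·Δ(p′ + 2πe_i) = B1U_{σl}(p′)·Δ(p′)`. [folklore] -/
theorem B1U_tr_mul (μ : Fin d) (k : Fin d → Fin n) {p : Fin d → ℂ} (i : Fin d) (hz : p i ≠ 0)
    (hz' : p i + 2 * Real.pi ≠ 0) (h0 : DeltaXi n 0 p ≠ 0) (h1 : DeltaXi n 0 (tr p i) ≠ 0)
    (hN : Ncal n p ≠ 0) (hY : YG n μ p ≠ 0)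
    (hD : ∀ k : Fin d → Fin n, k ≠ (fun _ => 0) → DeltaXi n 0 (shift n k p) ≠ 0) :
    B1U n μ k (tr p i) * DeltaXi n 0 (tr p i) = B1U n μ (sigma n i k) p * DeltaXi n 0 p := by
  have hYt : YG n μ (tr p i) = DeltaXi n 0 (tr p i) * YG n μ p / DeltaXi n 0 p :=
    eq_div_of_mul_eq h0 (YG_tr_mul n μ p i hz hz' h0 h1)
  have hNt : Ncal n (tr p i) = DeltaXi n 0 (tr p i) ^ 2 * Ncal n p / DeltaXi n 0 p ^ 2 :=
    eq_div_of_mul_eq (pow_ne_zero 2 h0) (Ncal_tr n p i hz hz' h0 h1)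
  have hsk := DeltaXi_shift_sigma_ne_zero n i h0 hD k
  unfold B1U
  rw [uCbar_tr, vCbar_tr, dC_tr, expFacPos_tr, DeltaXi_shift_tr, hYt, hNt]
  field_simp

/-- **THE SHIFT LAW OF THE SECOND BRACKET**: `B2U_{l′}(p′ + 2πe_i)·Δ(p′ + 2πe_i) = B2U_{σl′}(p′)·Δ(p′)`. [folklore] -/
theorem B2U_tr_mul (ν : Fin d) (k' : Fin d → Fin n) {p : Fin d → ℂ} (i : Fin d) (hz : p i ≠ 0)
    (hz' : p i + 2 * Real.pi ≠ 0) (h0 : DeltaXi n 0 p ≠ 0) (h1 : DeltaXi n 0 (tr p i) ≠ 0)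
    (hN : Ncal n p ≠ 0) (hY : YG n ν p ≠ 0)
    (hD : ∀ k : Fin d → Fin n, k ≠ (fun _ => 0) → DeltaXi n 0 (shift n k p) ≠ 0) :
    B2U n ν k' (tr p i) * DeltaXi n 0 (tr p i) = B2U n ν (sigma n i k') p * DeltaXi n 0 p := by
  have hYt : YG n ν (tr p i) = DeltaXi n 0 (tr p i) * YG n ν p / DeltaXi n 0 p :=
    eq_div_of_mul_eq h0 (YG_tr_mul n ν p i hz hz' h0 h1)
  have hNt : Ncal n (tr p i) = DeltaXi n 0 (tr p i) ^ 2 * Ncal n p / DeltaXi n 0 p ^ 2 :=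
    eq_div_of_mul_eq (pow_ne_zero 2 h0) (Ncal_tr n p i hz hz' h0 h1)
  have hsk := DeltaXi_shift_sigma_ne_zero n i h0 hD k'
  unfold B2U
  rw [uC_tr, vC_tr, dCbar_tr, expFacNeg_tr, DeltaXi_shift_tr, hYt, hNt]
  field_simp

/-- **THE SHIFT LAW OF THE MIDDLE SCALAR**: `midG(p′ + 2πe_i)·Δ(p′)² = midG(p′)·Δ(p′ + 2πe_i)²`
(`ΠY^G` picks up the `d`-th power of `Δ(p′+2πe_i)/Δ(p′)`, `F^G` the `(d−2)`-th). [folklore] -/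
theorem midG_tr_mul {p : Fin d → ℂ} (i : Fin d) (hz : p i ≠ 0)
    (hz' : p i + 2 * Real.pi ≠ 0) (h0 : DeltaXi n 0 p ≠ 0) (h1 : DeltaXi n 0 (tr p i) ≠ 0)
    (hF : FG n p ≠ 0) :
    midG n (tr p i) * DeltaXi n 0 p ^ 2 = midG n p * DeltaXi n 0 (tr p i) ^ 2 := by
  have hd1 : d = (d - 1) + 1 := (Nat.succ_pred_eq_of_pos (Fin.pos i)).symm
  have hP : ∏ lam : Fin d, YG n lam (tr p i) =
      DeltaXi n 0 (tr p i) ^ ((d - 1) + 1) * (∏ lam : Fin d, YG n lam p) / DeltaXi n 0 p ^ ((d - 1) + 1) := by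
    have h := prodYG_tr_mul n Finset.univ p i hz hz' h0 h1
    rw [Finset.card_univ, Fintype.card_fin] at h
    rw [← hd1]
    exact eq_div_of_mul_eq (pow_ne_zero d h0) h
  have hFt : FG n (tr p i) = DeltaXi n 0 (tr p i) ^ (d - 1) * (DeltaXi n 0 p * FG n p) /
      (DeltaXi n 0 (tr p i) * DeltaXi n 0 p ^ (d - 1)) := by
    have h := FG_tr_mul n p i hz hz' h0 h1
    refine eq_div_of_mul_eq (mul_ne_zero h1 (pow_ne_zero _ h0)) ?_
    rw [← h]; ring
  unfold midG
  rw [hP, hFt]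
  field_simp
  ring

/-- **EXACT COVARIANCE OF THE THIRD TERM**: `(midG·B1U_l·B2U_{l′})(p′ + 2πe_i) = (midG·B1U_{σl}·B2U_{σl′})(p′)`
(the powers `+2, −1, −1` of `Δ(p′+2πe_i)/Δ(p′)` cancel). [folklore] -/
theorem third_tr (μ ν : Fin d) (k k' : Fin d → Fin n) {p : Fin d → ℂ} (i : Fin d) (hz : p i ≠ 0)
    (hz' : p i + 2 * Real.pi ≠ 0) (h0 : DeltaXi n 0 p ≠ 0) (h1 : DeltaXi n 0 (tr p i) ≠ 0)
    (hF : FG n p ≠ 0) (hN : Ncal n p ≠ 0) (hY : ∀ lam, YG n lam p ≠ 0)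
    (hD : ∀ k : Fin d → Fin n, k ≠ (fun _ => 0) → DeltaXi n 0 (shift n k p) ≠ 0) :
    midG n (tr p i) * B1U n μ k (tr p i) * B2U n ν k' (tr p i)
      = midG n p * B1U n μ (sigma n i k) p * B2U n ν (sigma n i k') p := by
  have hM : midG n (tr p i) = midG n p * DeltaXi n 0 (tr p i) ^ 2 / DeltaXi n 0 p ^ 2 :=
    eq_div_of_mul_eq (pow_ne_zero 2 h0) (midG_tr_mul n i hz hz' h0 h1 hF)
  have hB1 : B1U n μ k (tr p i) = B1U n μ (sigma n i k) p * DeltaXi n 0 p / DeltaXi n 0 (tr p i) :=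
    eq_div_of_mul_eq h1 (B1U_tr_mul n μ k i hz hz' h0 h1 hN (hY μ) hD)
  have hB2 : B2U n ν k' (tr p i) = B2U n ν (sigma n i k') p * DeltaXi n 0 p / DeltaXi n 0 (tr p i) :=
    eq_div_of_mul_eq h1 (B2U_tr_mul n ν k' i hz hz' h0 h1 hN (hY ν) hD)
  rw [hM, hB1, hB2]
  field_simp

/-- **THE ALIAS RE-INDEXING COVARIANCE OF THE CONTINUED (1.83) ENTRY SYMBOL** across the strip sides: for
`p′ ∈ Strip d κ` (`0 ≤ κ ≤ κ₁₈₃(d)`) with `Re p′_i = −π`, every `n ≥ 1`, `μ, ν, l, l′`: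
`g_{μν}(l,l′; p′ + 2πe_i) = g_{μν}(σ_i l, σ_i l′; p′)`, `σ_i l = l + 2πe_i (mod 2πn)` — the translate of the left
side point is the right side point (`B4StripSums.tr_mem_Strip`) and the fiber matrix `(g(l,l′))_{l,l′}` is merely
CONJUGATED BY THE PERMUTATION `σ_i`; hence the fine-momentum kernel `Σ_{l,l′} e^{i(p′+l)x} g_{μν}(l,l′;p′) e^{−i(p′+l′)y}`
is `2π`-periodic across the sides, which is what the contour shift for (1.83)/(1.84) uses.  No per-`(l,l′)`
periodicity holds (each of `diagG`, `midG`, `B1`, `B2` is only quasi-periodic, `diagU_tr`, `midG_tr_mul`,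
`B1U_tr_mul`, `B2U_tr_mul`). [folklore] -/
theorem g183_tr {κ : ℝ} (hκ0 : 0 ≤ κ) (hκ : κ ≤ kappa183 d) {p : Fin d → ℂ} (hp : p ∈ Strip d κ)
    (i : Fin d) (hre : (p i).re = -Real.pi) (μ ν : Fin d) (k k' : Fin d → Fin n) :
    g183 n μ ν k k' (tr p i) = g183 n μ ν (sigma n i k) (sigma n i k') p := by
  have hn : 1 ≤ n := Nat.one_le_iff_ne_zero.mpr (NeZero.ne n)
  obtain ⟨hκ1, hdκ⟩ := kappa_small hκ0 (hκ.trans (kappa183_le_rOf d))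
  obtain ⟨hz, hz', h0, h1⟩ := edge_conditions n hκ1 hdκ hp i hre
  have hpt : tr p i ∈ Strip d κ := tr_mem_Strip hp i hre
  obtain ⟨hFp, hNp, hYp, hDp⟩ := denominators_ne_zero n hκ0 hκ hp
  obtain ⟨_, hNt, hYt, _⟩ := denominators_ne_zero n hκ0 hκ hpt
  rw [g183_eq_U n hn h1 hNt hYt (re_lt_two_pi hpt) μ ν k k',
    g183_eq_U n hn h0 hNp hYp (re_lt_two_pi hp) μ ν (sigma n i k) (sigma n i k'),
    third_tr n μ ν k k' i hz hz' h0 h1 hFp hNp hYp hDp]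
  congr 1
  split_ifs with h
  · exact diagU_tr n μ k k' i hz hz' h0 h1 (hYp μ) hDp
  · rfl

/-- the permuted double alias sum is the double alias sum: `Σ_{l,l′} ‖g(σl,σl′)‖ = Σ_{l,l′} ‖g(l,l′)‖` (so any
bound on the double alias sum at `p′` is a bound at `p′ + 2πe_i`; the sum itself is `n`-dependent, HONEST SCOPE (ii)).
[folklore] -/
theorem sum_norm_g183_sigma (μ ν i : Fin d) (p : Fin d → ℂ) :
    ∑ k : Fin d → Fin n, ∑ k' : Fin d → Fin n, ‖g183 n μ ν (sigma n i k) (sigma n i k') p‖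
      = ∑ k : Fin d → Fin n, ∑ k' : Fin d → Fin n, ‖g183 n μ ν k k' p‖ := by
  have h1 : ∑ k : Fin d → Fin n, ∑ k' : Fin d → Fin n, ‖g183 n μ ν (sigma n i k) (sigma n i k') p‖
      = ∑ k : Fin d → Fin n, ∑ k' : Fin d → Fin n, ‖g183 n μ ν k (sigma n i k') p‖ :=
    Equiv.sum_comp (sigmaEquiv n i) (fun k => ∑ k' : Fin d → Fin n, ‖g183 n μ ν k (sigma n i k') p‖)
  rw [h1]
  exact Finset.sum_congr rfl (fun k _ =>
    Equiv.sum_comp (sigmaEquiv n i) (fun k' => ‖g183 n μ ν k k' p‖))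

end Covariance

end Literature.MathematicalPhysics.QuantumFieldTheory.Balaban1983to89.B5G183Alias
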